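/-
Origin: expansion seat `planner-pub-hodgecm-toy-g5-0`, handover #3 v2 2026-08-18T14:41:32Z (md5 cba98a0f) (`HOME/pub-hodgecm-toy-g5/lean/ToyG5/HodgeRiemannRadical3.lean`, md5 cba98a0f, 266 lines);
landed by the gen-8 packager in gate run 31 as `HodgeCM/Model/ToyG2/HodgeRiemannRadical3.lean` (import ^import ToyG5\.HodgeRiemannKernel3[ \t]*$→import HodgeCM.Model.ToyG2.HodgeRiemannKernel3 ×1).
-/
-- HANDOVER (planner-pub-hodgecm-toy-g5-0, unit pub-hodgecm-toy-g5): WIP module `ToyG5.HodgeRiemannRadical3`; intended final module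
-- `HodgeCM.Model.ToyG2.HodgeRiemannRadical3` (kind L5, toy model / consistency witness, EXPANSION part (e), generation 5);
-- rename `import ToyG5.X` ↦ `import HodgeCM.Model.ToyG2.X` (one import: `HodgeRiemannKernel3`, file #2 of this seat).
/-
Copyright (c) 2026. All rights reserved.
Released under Apache 2.0 license as described in the file LICENSE.
-/
import Mathlib
import Summits.HodgeConjecture.HodgeCM.Model.ToyG2.HodgeRiemannKernel3
import Summits.HodgeConjecture.HodgeCM.Model.ToyG2.Good

/-!
# The kernel class `η_q` lies in the radical of the RATIONAL cup pairing on `H²(P_Γ)` — the quotient model is forced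

File #3 of generation 5 of the toy lineage (seat `planner-pub-hodgecm-toy-g5-0`), the diagnostic promised in
`HOME/pub-hodgecm-toy-g5/TOY-G5.md` §4.  File #2 (`HodgeRiemannKernel3`) produced, for the parameters `1 ≤ d`, `t² = 16` of the
realisation of record and every block `q` of every period surface `P_Γ = pms L ι₁ V Γ` of `toyUniverse₃ d t`, a nonzero
`(2,0)`-class `η_q = E₀ ∪ E₁ − κ • E₂ ∪ E₃` with `tr_ℂ(η_q ∪ η̄_q) = 0` (so `Fact_hodgeRiemann20` fails).  Here:

* `hr3_eta_orth_H10` — `η_q` is `h`-orthogonal to ALL of `H^{1,0} ∪ H^{1,0}`: `tr_ℂ(η_q ∪ conj(a ∪ b)) = 0` for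
  `a b ∈ H^{1,0}(P_Γ)` (Gram identity `inner_Λ₃` + kernel relation `Λ_theta01_eq_smul`);
* `hr3_radical_of_orth_H10` — GENERAL CRITERION: every `η ∈ F²H²(P_Γ)` which is `h`-orthogonal to `H^{1,0} ∪ H^{1,0}` pairs
  to zero with ALL of `H²(P_Γ, ℂ)` under `(x, z) ↦ tr(x ∪ z)` (the weight argument below; reusable for the cross-block classes of
  file #1 and for any future isotropic class);
* **`hr3_eta_radical` — `tr_ℂ(η_q ∪ z) = 0` for EVERY `z ∈ H²(P_Γ, ℂ)`**: `η_q` lies in the radical of the bilinear form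
  `(x, z) ↦ tr(x ∪ z)` on `H²(P_Γ) = ⋀² H¹(P_Γ)`, a form defined over `ℚ`.  Proof: `H²(P_Γ, ℂ)` has the wedge basis of
  eigen-monomials `e_g = e_{s₀} ∧ e_{s₁}` (`Obj.eB.exteriorPower 2`, `basis_eq_mono`); if some index of `g` is holomorphic,
  `η_q ∧ e_g` has holomorphic count `≥ 3` while the period functional `ℓ` of `P(L, ι₁)` has Hodge type `(2,2)` (toy-g2
  `Good.isType22_pLeafOf`), so `tr(η_q ∪ e_g) = 0` by the weight operator at `z = 2` (`HodgeWeight`: `Obj.wt`, `Obj.pureSpan`);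
  if no index is holomorphic, `e_g = conj(a ∪ b)` with `a, b ∈ H^{1,0}` and the first bullet applies.

CONSEQUENCE (the repair direction of TOY-G5.md §4, now a theorem about the model): the radical
`N = rad(tr ∘ ∪)` of the rational cup pairing on `⋀² H¹(P_Γ)` is NONZERO and contains every kernel class `η_q`
(`hr3_radical_witness`); any universe built on the same `H¹` and the same period functional in which `tr ∘ ∪` is a perfect
pairing on `H²` (Poincaré duality for the surface `P_Γ`) must therefore replace `⋀² H¹` by (a quotient of) `⋀² H¹ / N`; on
`F²` the Hodge–Riemann form of the realisation of record is the Gram form of `Λ` (`hr3_period4_eq_inner`), so the expectation —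
NOT proved here — is that it becomes definite on `F²` of such a quotient.  Nothing cited, nothing posited, no unfinished proofs.
-/

open scoped TensorProduct InnerProductSpace
open HodgeCM.Toy HodgeCM.Toy.CMPresentation exteriorPower NumberField.ComplexEmbedding
open Literature.AlgebraicGeometry.Motives
open Literature.AlgebraicGeometry.Motives.HodgeStructure (conj conj_smul conj_conj conj_baseChange)

namespace HodgeCM.ToyG2

open ThetaUiso

noncomputable section

/-! ### §0 Generic expansion -/

/-- `tr((p ∪ q − κ • r ∪ s) ∪ conj(a ∪ b)) = P(p,q,a,b) − κ P(r,s,a,b)`, `P = period4` (any Universe, `κ ∈ ℝ`) -/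
theorem hr3r_trC_sub_smul_conj (U : Universe) (X : U.Var) (p q r s a b : U.CohC X 1) (κ : ℝ) :
    U.trC X 4 (U.cup2C X 2 (U.cup2C X 1 p q - (κ : ℂ) • U.cup2C X 1 r s) (conj (U.cup2C X 1 a b)))
      = U.period4 X p q a b - κ * U.period4 X r s a b := by
  have hc : (conj (U.cup2C X 1 a b) : U.CohC X 2) = U.cup2C X 1 (conj a) (conj b) :=
    Universe.conj_cup2C X 1 a b
  simp only [map_sub, map_smul, LinearMap.sub_apply, LinearMap.smul_apply, hc, Universe.period4, Universe.quadC,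
    smul_eq_mul]

section Main

variable (d t : ℚ) {L : CMField} (ι₁ : L →+* ℂ) {V : HermSpace3 L ι₁} (Γ : Level V)
  (hd : (1 : ℚ) ≤ d) (ht : t ^ 2 = 16) (q : Fin (nQ L ι₁))

/-! ### §1 `η_q ⊥_h H^{1,0} ∪ H^{1,0}` -/

include hd ht in
/-- **`tr_ℂ(η_q ∪ conj(a ∪ b)) = 0` for all `(1,0)`-classes `a, b`** (Gram identity + kernel relation). -/
theorem hr3_eta_orth_H10 (a b : (toyUniverse₃ d t).CohC ((toyUniverse₃ d t).pms L ι₁ V Γ) 1)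
    (ha : a ∈ (toyUniverse₃ d t).H10 ((toyUniverse₃ d t).pms L ι₁ V Γ))
    (hb : b ∈ (toyUniverse₃ d t).H10 ((toyUniverse₃ d t).pms L ι₁ V Γ)) :
    (toyUniverse₃ d t).trC ((toyUniverse₃ d t).pms L ι₁ V Γ) 4
      ((toyUniverse₃ d t).cup2C ((toyUniverse₃ d t).pms L ι₁ V Γ) 2 (hr3_eta d t ι₁ Γ hd ht q)
        (conj ((toyUniverse₃ d t).cup2C ((toyUniverse₃ d t).pms L ι₁ V Γ) 1 a b))) = 0 := by
  have hH := hr3k_eCls_mem_H10 d t ι₁ Γ q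
  have hθ := hr3k_embOf_hol ι₁ q
  unfold hr3_eta
  rw [hr3r_trC_sub_smul_conj, hr3_period4_eq_inner d t ι₁ Γ hd ht _ _ _ _ (hH 0) (hH 1) ha hb,
    hr3_period4_eq_inner d t ι₁ Γ hd ht _ _ _ _ (hH 2) (hH 3) ha hb]
  have hAB : Λ ι₁ d t hd ht (eCls ι₁ d t q 0 (embOf L ι₁)) (eCls ι₁ d t q 1 (embOf L ι₁))
      = Λ ι₁ d t hd ht (eCls ι₁ d t q 2 (embOf L ι₁))
          (((hr3_κ d t ι₁ hd ht q : ℝ) : ℂ) • eCls ι₁ d t q 3 (embOf L ι₁)) := by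
    rw [LinearMap.map_smul]
    exact Λ_theta01_eq_smul ι₁ d t q hd ht (hθ 0) (hθ 1) (hθ 2) (hθ 3)
  rw [hAB, LinearMap.map_smul]
  generalize Λ ι₁ d t hd ht (eCls ι₁ d t q 2 (embOf L ι₁)) (eCls ι₁ d t q 3 (embOf L ι₁)) = B
  generalize Λ ι₁ d t hd ht a b = C
  generalize hr3_κ d t ι₁ hd ht q = k
  rw [inner_smul_right]
  ring

/-! ### §2 Exterior-model bookkeeping on the period surface `P_Γ` (`H^k(P_Γ, ℂ) = ℂ ⊗ ⋀^k L(P(L, ι₁))`) -/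

/-- `Θ₄ (x ∪ z) = Θ₂ x ∧ Θ₂ z` -/
theorem hr3r_theta_cup2C (x z : (toyUniverse₃ d t).CohC ((toyUniverse₃ d t).pms L ι₁ V Γ) 2) :
    (PO ι₁ d t).Θ 4 ((toyUniverse₃ d t).cup2C ((toyUniverse₃ d t).pms L ι₁ V Γ) 2 x z)
      = wedge ℂ (PO ι₁ d t).LC 2 2 ((PO ι₁ d t).Θ 2 x) ((PO ι₁ d t).Θ 2 z) :=
  (PO ι₁ d t).theta_cup2_two x z

/-- `F²H²(P_Γ)` consists of combinations of monomials with two holomorphic indices -/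
theorem hr3r_theta_mem_pureSpan {x : (toyUniverse₃ d t).CohC ((toyUniverse₃ d t).pms L ι₁ V Γ) 2}
    (hx : x ∈ ((toyUniverse₃ d t).hodge ((toyUniverse₃ d t).pms L ι₁ V Γ) 2).F 2) :
    (PO ι₁ d t).Θ 2 x ∈ (PO ι₁ d t).pureSpan 2 2 := by
  have hx' : x ∈ (exteriorHodgeData.hs (PO ι₁ d t) 2).F 2 := hx
  have h : (PO ι₁ d t).Θ 2 x ∈ (PO ι₁ d t).FF 2 2 := (PO ι₁ d t).mem_hodgeF.mp hx'
  have hle : (PO ι₁ d t).FF 2 2 ≤ (PO ι₁ d t).pureSpan 2 2 := by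
    unfold Obj.FF Obj.pureSpan
    apply Submodule.span_mono
    rintro _ ⟨g, hg, rfl⟩
    exact ⟨g, le_antisymm ((PO ι₁ d t).cnt_le g) (by exact_mod_cast hg), rfl⟩
  exact hle h

/-- generic weight bookkeeping: `wt₂ (x ∧ y) = (2² · 2^m) (x ∧ y)` for `x` pure of holomorphic count `2`, `y` of count `m` -/
theorem hr3r_wt_wedge_pure (X : Obj) {x y : ⋀[ℂ]^2 X.LC} (hx : x ∈ X.pureSpan 2 2) {m : ℕ}
    (hy : y ∈ X.pureSpan 2 m) :
    X.wt 2 (2 + 2) (wedge ℂ X.LC 2 2 x y) = ((2 : ℂ) ^ 2 * 2 ^ m) • wedge ℂ X.LC 2 2 x y := by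
  rw [Obj.wt_wedge, Obj.wt_eq_of_mem_pureSpan _ 2 hx, Obj.wt_eq_of_mem_pureSpan _ 2 hy, LinearMap.map_smul₂,
    map_smul, smul_smul]

/-- the weight argument (generic period leaf `p` whose trace functional has Hodge type `(2,2)`):
`ℓ_ℂ(x ∧ y) = 0` for `x` pure of holomorphic count `2` and `y` pure of count `m ≠ 0` -/
theorem hr3r_ell_wedge_eq_zero (p : PLeaf) (hp : p.IsType22) {x y : ⋀[ℂ]^2 p.O.LC} (hx : x ∈ p.O.pureSpan 2 2)
    {m : ℕ} (hm : m ≠ 0) (hy : y ∈ p.O.pureSpan 2 m) :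
    baseC p.O p.ℓ (wedge ℂ p.O.LC 2 2 x y) = 0 := by
  have hw : p.O.wt 2 4 (wedge ℂ p.O.LC 2 2 x y) = ((2 : ℂ) ^ 2 * 2 ^ m) • wedge ℂ p.O.LC 2 2 x y :=
    hr3r_wt_wedge_pure p.O hx hy
  have h22 := LinearMap.congr_fun (hp 2) (wedge ℂ p.O.LC 2 2 x y)
  rw [LinearMap.comp_apply, LinearMap.smul_apply, hw, map_smul, smul_eq_mul, smul_eq_mul] at h22
  -- h22 : 2 ^ 2 * 2 ^ m * ℓ = 2 ^ 2 * ℓ, and 2 ^ m ≠ 1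
  have h5 : (2 : ℂ) ^ 2 * (2 ^ m - 1) ≠ 0 :=
    mul_ne_zero (pow_ne_zero 2 two_ne_zero) (sub_ne_zero.mpr (Obj.two_generic m (Nat.pos_of_ne_zero hm)))
  exact (mul_eq_zero.mp
    (by linear_combination h22 : (2 : ℂ) ^ 2 * (2 ^ m - 1) * baseC p.O p.ℓ (wedge ℂ p.O.LC 2 2 x y) = 0)).resolve_left h5

/-- complex conjugation permutes the eigenbasis of `ℂ ⊗ L(P(L, ι₁))`: `conj e_s = e_{s̄}` -/
theorem hr3r_conj_eB (s : (PO ι₁ d t).Idx) : conj ((PO ι₁ d t).eB s) = (PO ι₁ d t).eB ((PO ι₁ d t).bar s) := by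
  rw [Obj.eB_apply', Obj.eB_apply', Obj.eT, Obj.eT, conj_baseChange, conj_eps]
  rfl

/-- `conj` commutes with `form1` -/
theorem hr3r_conj_form1 (v : (PO ι₁ d t).LC) : conj ((PO ι₁ d t).form1 v) = (PO ι₁ d t).form1 (conj v) :=
  conj_baseChange _ v

/-- a holomorphic eigenvector is a `(1,0)`-class of the period surface -/
theorem hr3r_form1_eB_mem_H10 {s : (PO ι₁ d t).Idx} (hs : (PO ι₁ d t).hol s) :
    (PO ι₁ d t).form1 ((PO ι₁ d t).eB s) ∈ (toyUniverse₃ d t).H10 ((toyUniverse₃ d t).pms L ι₁ V Γ) := by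
  have h1 : (PO ι₁ d t).form1 ((PO ι₁ d t).eB s) ∈ (exteriorHodgeData.hs (PO ι₁ d t) 1).F 1 := by
    rw [exteriorHodgeData.deg1, Obj.F1filt, if_neg (show ¬ ((1 : ℤ) ≤ 0) by norm_num),
      if_pos (show (1 : ℤ) = 1 from rfl)]
    exact ⟨(PO ι₁ d t).eB s, (PO ι₁ d t).eB_mem_F1 hs, rfl⟩
  have h0 : conj ((PO ι₁ d t).form1 ((PO ι₁ d t).eB s)) ∈ (exteriorHodgeData.hs (PO ι₁ d t) 1).F 0 := by
    rw [exteriorHodgeData.deg1, Obj.F1filt, if_pos (le_refl (0 : ℤ))]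
    exact Submodule.mem_top
  exact ((exteriorHodgeData.hs (PO ι₁ d t) 1).mem_piece_iff (by norm_num)).mpr ⟨h1, h0⟩

/-- a monomial `e_{s₀} ∧ e_{s₁}` with NO holomorphic index is `conj(a ∪ b)` for the `(1,0)`-classes `a = e_{s̄₀}`, `b = e_{s̄₁}` -/
theorem hr3r_mono_eq_conj_cup (g : Fin 2 → (PO ι₁ d t).Idx) :
    ((PO ι₁ d t).Θ 2).symm ((PO ι₁ d t).mono 2 g)
      = (conj ((toyUniverse₃ d t).cup2C ((toyUniverse₃ d t).pms L ι₁ V Γ) 1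
          ((PO ι₁ d t).form1 ((PO ι₁ d t).eB ((PO ι₁ d t).bar (g 0))))
          ((PO ι₁ d t).form1 ((PO ι₁ d t).eB ((PO ι₁ d t).bar (g 1))))) :
            (toyUniverse₃ d t).CohC ((toyUniverse₃ d t).pms L ι₁ V Γ) 2) := by
  have hc : (conj ((toyUniverse₃ d t).cup2C ((toyUniverse₃ d t).pms L ι₁ V Γ) 1
          ((PO ι₁ d t).form1 ((PO ι₁ d t).eB ((PO ι₁ d t).bar (g 0))))
          ((PO ι₁ d t).form1 ((PO ι₁ d t).eB ((PO ι₁ d t).bar (g 1))))) :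
            (toyUniverse₃ d t).CohC ((toyUniverse₃ d t).pms L ι₁ V Γ) 2)
      = (toyUniverse₃ d t).cup2C ((toyUniverse₃ d t).pms L ι₁ V Γ) 1
          ((PO ι₁ d t).form1 ((PO ι₁ d t).eB (g 0))) ((PO ι₁ d t).form1 ((PO ι₁ d t).eB (g 1))) := by
    have e1 : ∀ s : (PO ι₁ d t).Idx,
        (conj ((PO ι₁ d t).form1 ((PO ι₁ d t).eB ((PO ι₁ d t).bar s))) :
            (toyUniverse₃ d t).CohC ((toyUniverse₃ d t).pms L ι₁ V Γ) 1)
          = (PO ι₁ d t).form1 ((PO ι₁ d t).eB s) := by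
      intro s
      show conj (V := ↥(⋀[ℚ]^1 (PO ι₁ d t).L)) ((PO ι₁ d t).form1 ((PO ι₁ d t).eB ((PO ι₁ d t).bar s))) = _
      rw [hr3r_conj_form1, hr3r_conj_eB, Obj.bar_bar]
    have e := Universe.conj_cup2C ((toyUniverse₃ d t).pms L ι₁ V Γ) 1
      ((PO ι₁ d t).form1 ((PO ι₁ d t).eB ((PO ι₁ d t).bar (g 0))))
      ((PO ι₁ d t).form1 ((PO ι₁ d t).eB ((PO ι₁ d t).bar (g 1))))
    rw [e1 (g 0), e1 (g 1)] at e
    exact e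
  rw [hc, LinearEquiv.symm_apply_eq]
  have h2 := theta_pair (PO ι₁ d t) ((PO ι₁ d t).eB (g 0)) ((PO ι₁ d t).eB (g 1))
  rw [Obj.mono_def, show (PO ι₁ d t).eB ∘ g = ![(PO ι₁ d t).eB (g 0), (PO ι₁ d t).eB (g 1)] from by
    funext j; fin_cases j <;> rfl]
  exact h2.symm

/-! ### §3 The radical theorem -/

/-- GENERAL CRITERION, on eigen-monomials: a `(2,0)`-class `η` which is `h`-orthogonal to `H^{1,0} ∪ H^{1,0}` pairs to zero with
every eigen-monomial `Θ₂⁻¹(e_g)`. -/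
theorem hr3r_trC_mono_of_orth {η : (toyUniverse₃ d t).CohC ((toyUniverse₃ d t).pms L ι₁ V Γ) 2}
    (hF : η ∈ ((toyUniverse₃ d t).hodge ((toyUniverse₃ d t).pms L ι₁ V Γ) 2).F 2)
    (horth : ∀ a b : (toyUniverse₃ d t).CohC ((toyUniverse₃ d t).pms L ι₁ V Γ) 1,
      a ∈ (toyUniverse₃ d t).H10 ((toyUniverse₃ d t).pms L ι₁ V Γ) →
      b ∈ (toyUniverse₃ d t).H10 ((toyUniverse₃ d t).pms L ι₁ V Γ) →
      (toyUniverse₃ d t).trC ((toyUniverse₃ d t).pms L ι₁ V Γ) 4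
        ((toyUniverse₃ d t).cup2C ((toyUniverse₃ d t).pms L ι₁ V Γ) 2 η
          (conj ((toyUniverse₃ d t).cup2C ((toyUniverse₃ d t).pms L ι₁ V Γ) 1 a b))) = 0)
    (g : Fin 2 → (PO ι₁ d t).Idx) :
    (toyUniverse₃ d t).trC ((toyUniverse₃ d t).pms L ι₁ V Γ) 4
      ((toyUniverse₃ d t).cup2C ((toyUniverse₃ d t).pms L ι₁ V Γ) 2 η
        (((PO ι₁ d t).Θ 2).symm ((PO ι₁ d t).mono 2 g))) = 0 := by
  by_cases hg : (PO ι₁ d t).hol (g 0) ∨ (PO ι₁ d t).hol (g 1)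
  · -- some index holomorphic: holomorphic count ≥ 3 against a functional of type (2,2)
    have hm : (PO ι₁ d t).cnt g ≠ 0 := by
      rcases hg with h | h
      · exact Finset.card_ne_zero_of_mem (((PO ι₁ d t).mem_holSlots g 0).mpr h)
      · exact Finset.card_ne_zero_of_mem (((PO ι₁ d t).mem_holSlots g 1).mpr h)
    rw [trC_eq_baseC₃, hr3r_theta_cup2C, LinearEquiv.apply_symm_apply]
    exact hr3r_ell_wedge_eq_zero (pLeafOf L ι₁ d t) (isType22_pLeafOf L ι₁ d t)
      (hr3r_theta_mem_pureSpan d t ι₁ Γ hF) hm (Submodule.subset_span ⟨g, rfl, rfl⟩)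
  · -- no index holomorphic: `e_g = conj(a ∪ b)` with `a, b ∈ H^{1,0}`
    rw [not_or] at hg
    rw [hr3r_mono_eq_conj_cup]
    exact horth _ _
      (hr3r_form1_eB_mem_H10 d t ι₁ Γ (((PO ι₁ d t).hol_bar_iff _).mpr hg.1))
      (hr3r_form1_eB_mem_H10 d t ι₁ Γ (((PO ι₁ d t).hol_bar_iff _).mpr hg.2))

/-- **GENERAL CRITERION.** A `(2,0)`-class `η ∈ F²H²(P_Γ)` which is `h`-orthogonal to `H^{1,0} ∪ H^{1,0}`
(`tr_ℂ(η ∪ conj(a ∪ b)) = 0` for all `a b ∈ H^{1,0}`) lies in the radical of the rational cup pairing: `tr_ℂ(η ∪ z) = 0` for every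
`z ∈ H²(P_Γ, ℂ)`. -/
theorem hr3_radical_of_orth_H10 {η : (toyUniverse₃ d t).CohC ((toyUniverse₃ d t).pms L ι₁ V Γ) 2}
    (hF : η ∈ ((toyUniverse₃ d t).hodge ((toyUniverse₃ d t).pms L ι₁ V Γ) 2).F 2)
    (horth : ∀ a b : (toyUniverse₃ d t).CohC ((toyUniverse₃ d t).pms L ι₁ V Γ) 1,
      a ∈ (toyUniverse₃ d t).H10 ((toyUniverse₃ d t).pms L ι₁ V Γ) →
      b ∈ (toyUniverse₃ d t).H10 ((toyUniverse₃ d t).pms L ι₁ V Γ) →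
      (toyUniverse₃ d t).trC ((toyUniverse₃ d t).pms L ι₁ V Γ) 4
        ((toyUniverse₃ d t).cup2C ((toyUniverse₃ d t).pms L ι₁ V Γ) 2 η
          (conj ((toyUniverse₃ d t).cup2C ((toyUniverse₃ d t).pms L ι₁ V Γ) 1 a b))) = 0)
    (z : (toyUniverse₃ d t).CohC ((toyUniverse₃ d t).pms L ι₁ V Γ) 2) :
    (toyUniverse₃ d t).trC ((toyUniverse₃ d t).pms L ι₁ V Γ) 4
      ((toyUniverse₃ d t).cup2C ((toyUniverse₃ d t).pms L ι₁ V Γ) 2 η z) = 0 := by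
  -- the functional `z ↦ tr(η ∪ z)` vanishes on the monomial basis `Θ₂⁻¹(e_g)` of `H²(P_Γ, ℂ)`
  have hψ : (toyUniverse₃ d t).trC ((toyUniverse₃ d t).pms L ι₁ V Γ) 4
      ∘ₗ (toyUniverse₃ d t).cup2C ((toyUniverse₃ d t).pms L ι₁ V Γ) 2 η = 0 := by
    refine (((PO ι₁ d t).eB.exteriorPower 2).map ((PO ι₁ d t).Θ 2).symm).ext fun S => ?_
    rw [Module.Basis.map_apply, basis_eq_mono (PO ι₁ d t) S]
    exact hr3r_trC_mono_of_orth d t ι₁ Γ hF horth _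
  exact LinearMap.congr_fun hψ z

include hd ht in
/-- **RADICAL THEOREM.** `tr_ℂ(η_q ∪ z) = 0` for every `z ∈ H²(P_Γ, ℂ)`: the kernel class of block `q` lies in the radical of the
rational cup pairing `(x, z) ↦ tr(x ∪ z)` on `H²(P_Γ) = ⋀² H¹(P_Γ)`. -/
theorem hr3_eta_radical (z : (toyUniverse₃ d t).CohC ((toyUniverse₃ d t).pms L ι₁ V Γ) 2) :
    (toyUniverse₃ d t).trC ((toyUniverse₃ d t).pms L ι₁ V Γ) 4
      ((toyUniverse₃ d t).cup2C ((toyUniverse₃ d t).pms L ι₁ V Γ) 2 (hr3_eta d t ι₁ Γ hd ht q) z) = 0 :=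
  hr3_radical_of_orth_H10 d t ι₁ Γ (hr3_eta_mem_F2 d t ι₁ Γ hd ht q) (hr3_eta_orth_H10 d t ι₁ Γ hd ht q) z

include hd ht q in
/-- **Corollary.** The radical of the rational cup pairing on `H²(P_Γ)` is not zero: it contains the nonzero class `η_q`
(`hr3_eta_ne_zero`).  Stated over `ℂ`: some nonzero `η ∈ F²H²(P_Γ)` pairs to zero with all of `H²(P_Γ, ℂ)`. -/
theorem hr3_radical_witness :
    ∃ η : (toyUniverse₃ d t).CohC ((toyUniverse₃ d t).pms L ι₁ V Γ) 2,
      η ∈ ((toyUniverse₃ d t).hodge ((toyUniverse₃ d t).pms L ι₁ V Γ) 2).F 2 ∧ η ≠ 0 ∧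
      ∀ z, (toyUniverse₃ d t).trC ((toyUniverse₃ d t).pms L ι₁ V Γ) 4
        ((toyUniverse₃ d t).cup2C ((toyUniverse₃ d t).pms L ι₁ V Γ) 2 η z) = 0 :=
  ⟨hr3_eta d t ι₁ Γ hd ht q, hr3_eta_mem_F2 d t ι₁ Γ hd ht q, hr3_eta_ne_zero d t ι₁ Γ hd ht q,
    hr3_eta_radical d t ι₁ Γ hd ht q⟩

end Main

end

end HodgeCM.ToyG2
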